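import Mathlib.Analysis.Complex.TaylorSeries
import Mathlib.Analysis.Complex.Liouville
import Mathlib.Analysis.Normed.Group.Tannery
import Mathlib.Analysis.SpecificLimits.Basic
import HarnessLib

/-!
# Limits of uniformly bounded analytic families from the convergence of their Taylor coefficients

Topic `Literature/Analysis/Complex`.  The thermodynamic limit `L → ∞` of the correlation functions in
constructive fermionic renormalization (Benfatto–Giuliani–Mastropietro 2006, the remark after
Thm. 2.1: "under the assumptions of the Theorem, `lim_{L→∞} F_{L,β}` does exist", and §2.9 for the
Schwinger functions) is taken as follows: at finite `L` the quantity is an analytic function of the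
coupling `U` in a disc `|U| ≤ R` with a bound *uniform in `L`* (this is the content of the multiscale
bounds), and each coefficient of its expansion in `U` — a finite-volume perturbative coefficient, a
finite sum of Riemann sums — converges as `L → ∞`; then the functions themselves converge in the
open disc (a special case of Vitali's theorem, here via Cauchy's estimates and Tannery's theorem):

* `norm_inv_factorial_smul_iteratedDeriv_le` — Cauchy's estimate `‖f⁽ⁿ⁾(0)/n!‖ ≤ M / Rⁿ`;
* `tendsto_of_forall_tendsto_taylorCoeff` — if `F_i` are complex differentiable on `|z| < R`,
  continuous on `|z| ≤ R`, bounded by `M` on `|z| = R` uniformly in `i`, and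
  `F_i⁽ⁿ⁾(0)/n! → aₙ` along a filter for every `n`, then `F_i(z) → Σₙ zⁿ aₙ` for every `|z| < R`.

Everything is proved; no named fact. [folklore]

## Sources

G. Benfatto, A. Giuliani, V. Mastropietro, Ann. Henri Poincaré 7 (2006), Thm. 2.1 (remark) and §2.9
(`BenfattoGiulianiMastropietro2006`).
-/

noncomputable section

open Filter Metric Complex
open scoped Topology Nat

namespace Literature.Analysis.Complex

variable {E : Type*} [NormedAddCommGroup E] [NormedSpace ℂ E] [CompleteSpace E]

/-- **Cauchy's estimate for the Taylor coefficients**: `‖f⁽ⁿ⁾(0)/n!‖ ≤ M/Rⁿ` for `f` complex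
differentiable on `|z| < R`, continuous on the closure, `‖f‖ ≤ M` on `|z| = R`. [folklore] -/
theorem norm_inv_factorial_smul_iteratedDeriv_le {f : ℂ → E} {R M : ℝ} (hR : 0 < R) (hf : DiffContOnCl ℂ f (ball 0 R))
    (hM : ∀ z ∈ sphere (0 : ℂ) R, ‖f z‖ ≤ M) (n : ℕ) :
    ‖(n ! : ℂ)⁻¹ • iteratedDeriv n f 0‖ ≤ M / R ^ n := by
  have h := Complex.norm_iteratedDeriv_le_of_forall_mem_sphere_norm_le n hR hf hM
  have hn : (0 : ℝ) < n ! := by exact_mod_cast Nat.factorial_pos n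
  rw [norm_smul, norm_inv, Complex.norm_natCast, inv_mul_le_iff₀ hn]
  calc ‖iteratedDeriv n f 0‖ ≤ n ! * M / R ^ n := h
    _ = (n ! : ℝ) * (M / R ^ n) := by ring

/-- **Convergence of a uniformly bounded analytic family from the convergence of its Taylor
coefficients** (the thermodynamic limit from finite-volume perturbation theory plus uniform
analyticity bounds; Benfatto–Giuliani–Mastropietro 2006, remark after Thm. 2.1 and §2.9). [cite: BenfattoGiulianiMastropietro2006, Thm. 2.1 (remark) and §2.9] -/
theorem tendsto_of_forall_tendsto_taylorCoeff {ι : Type*} {l : Filter ι} {F : ι → ℂ → E} {R M : ℝ}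
    (hR : 0 < R) (hd : ∀ i, DiffContOnCl ℂ (F i) (ball 0 R))
    (hM : ∀ i, ∀ z ∈ sphere (0 : ℂ) R, ‖F i z‖ ≤ M) {a : ℕ → E}
    (ha : ∀ n, Tendsto (fun i => (n ! : ℂ)⁻¹ • iteratedDeriv n (F i) 0) l (𝓝 (a n)))
    {z : ℂ} (hz : ‖z‖ < R) : Tendsto (fun i => F i z) l (𝓝 (∑' n, z ^ n • a n)) := by
  -- Taylor expansion of each `F i` at `0`
  have hzb : z ∈ ball (0 : ℂ) R := by rwa [mem_ball, dist_zero_right]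
  have hsum : ∀ i, HasSum (fun n => z ^ n • ((n ! : ℂ)⁻¹ • iteratedDeriv n (F i) 0)) (F i z) := by
    intro i
    have h := Complex.hasSum_taylorSeries_on_ball (hd i).differentiableOn hzb
    simp only [sub_zero] at h
    convert h using 1
    funext n
    rw [smul_comm]
  have heq : (fun i => F i z) = fun i => ∑' n, z ^ n • ((n ! : ℂ)⁻¹ • iteratedDeriv n (F i) 0) :=
    funext fun i => ((hsum i).tsum_eq).symm
  rw [heq]
  -- dominated convergence of the series (Tannery), with the geometric bound from Cauchy's estimate
  have hr0 : 0 ≤ ‖z‖ / R := div_nonneg (norm_nonneg _) hR.le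
  have hr1 : ‖z‖ / R < 1 := (div_lt_one hR).2 hz
  refine tendsto_tsum_of_dominated_convergence (bound := fun n => M * (‖z‖ / R) ^ n)
    ((summable_geometric_of_lt_one hr0 hr1).mul_left M) (fun n => (ha n).const_smul (z ^ n))
    (Eventually.of_forall fun i n => ?_)
  rw [norm_smul, norm_pow]
  calc ‖z‖ ^ n * ‖(n ! : ℂ)⁻¹ • iteratedDeriv n (F i) 0‖ ≤ ‖z‖ ^ n * (M / R ^ n) :=
        mul_le_mul_of_nonneg_left (norm_inv_factorial_smul_iteratedDeriv_le hR (hd i) (hM i) n) (pow_nonneg (norm_nonneg _) n)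
    _ = M * (‖z‖ / R) ^ n := by rw [div_pow]; ring

end Literature.Analysis.Complex
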